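/-
Copyright: the b2b-balaban T⁴-continuum CRUX team, row NE7b OWNER lineage `t4-ne7b-p1` (gen 123). Project licence.
-/
import Summits.QuantumFields.BalabanUV.T4Continuum.Spine.NE7b.SupTorusBlockL1Profile
import Summits.QuantumFields.BalabanUV.T4Continuum.Spine.NE7b.SupTorusPerturbedProfile

/-!
# THE BLOCK-`ℓ¹` NORMS AND BLOCK MEANS OF `(H + K)⁻¹f` INHERIT THE SOURCE'S EXPONENTIAL SUP PROFILE ON THE ROAD'S CLASS `V ≥ −λ`, AND THE
# LOCAL LETTER OF WEIGHTED INTERIOR REGULARITY FOR THE PERTURBED EQUATION: `|f| ≤ M·e^{−γ′ρ_s(bt ·, y₀)}`, `|K(x,z)| ≤ εe^{−γρ_N(x,z)}`,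
# `εK_{γ−κ} < m_κ`, `2κ ≤ γ′` ⟹ `Σ_{B_y}|u| ≤ (n+1)^d(m_κ − εK_{γ−κ})⁻¹e^{2dκ}·M·K_{2κ}·e^{−κρ_s(y,y₀)}` (Cauchy–Schwarz on (167)); the
# second-difference sum at a site from `(H + K)u = f`, the kernel term entering like the potential term — (153) RE-RUN for `H + K`, the
# inputs of the next file's pointwise DECAY of `(H + K)⁻¹f` (row NE7b, node U5c; (144)∕(153)∕(167) BY NAME; [folklore])

Cell `pub-balaban`, sub-cell `t4`, spine estimate NE7b (`T4WeightBudget.RelWeightBound`; the cell's OWN estimate — NOT PRINTED in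
[Bałaban 1983–89], NOT PROVED).  Crux-route work under `Spine/NE7b/` by the row OWNER (`t4-ne7b-p1` gen 123, file (173)) under FREEZE
(0)'s crux-prover clause; NOTHING of Bałaban's is named as a Lean object, valued or asserted; no `T4Continuum/Support` leaf typed; no `def`,
no notation (the action `(H + K)u` DISPLAYED exactly as in (162)–(172)); zero `sorry`.  Imports (BY NAME): the OWNER's (153)
`…SupTorusBlockL1Profile` (for its closure: (144) `blockTerm_eq`, [B6] `card_cube`, the torus dictionary `blockOf_siteOf_of_mem`), (167)
`…SupTorusPerturbedProfile` (`perturbed_blockSq_le_of_blockProfile_source`).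

WHY (located).  (154)'s pointwise decay localises the interior estimate with exponential weights; every quantity on the cube about the
maximum of the weighted modulus must carry the source's profile.  For `H + K` the block-`ℓ¹` norms do so by Cauchy–Schwarz on (167)'s
block-`ℓ²` bound, read at the block profile `Σ_{B_y}f² ≤ (n+1)^d M²e^{−2γ′ρ_s(y,y₀)}` of a sup-profile source (§1; no duality, no symmetry of
`K`); the block means are `(n+1)^{−d}` times the block-`ℓ¹` norms; and the displayed perturbed equation bounds the second-difference sum at
a site by its local data with the kernel term `|(Ku)(x′)| ≤ K′E′S` added to the zeroth-order term `|Vu| ≤ LE′S` (§2).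

WHAT IS PROVED ([folklore]; fine torus `Site d ((n+1)s)`, coarse `Site d s`, `[NeZero s]`; `(H + K)u` DISPLAYED; `σ = siteOf`, `bt x =
σ_s(blk n (wm x))`, `ρ_s` the `ℓ¹` circular distance; `m_κ = min(2,a) − λ − 2dκ² − a(e^{2dκ} − 1)`; `K_α = (2∕(1 − e^{−α}))^d`):
* §1 (`a ≥ 0`, `0 < κ ≤ 1`, `κ < γ`, `ε ≥ 0`, `εK_{γ−κ} < m_κ`, `2κ ≤ γ′`, `V ≥ −λ`, `|K| ≤ εe^{−γρ_N}`, `|f| ≤ Me^{−γ′ρ_s(bt ·, y₀)}`, `(H + K)u = f`)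
  `supProfile_blockSq_le` (the block profile of a sup-profile source: `Σ_z f(σ(chart (wm y) z))² ≤ (√((n+1)^d)M)²e^{−2γ′ρ_s(y,y₀)}`);
  **`perturbed_blockL1_le_of_supProfile`** (`Σ_z|u(σ(chart (wm y) z))| ≤ (n+1)^d(m_κ − εK_{γ−κ})⁻¹e^{2dκ}·M·K_{2κ}·e^{−κρ_s(y,y₀)}`);
  **`perturbed_blockMean_le_of_supProfile`** (`|(n+1)^{−d}Σ_z u(σ(chart (wm y) z))| ≤ (m_κ − εK_{γ−κ})⁻¹e^{2dκ}·M·K_{2κ}·e^{−κρ_s(y,y₀)}`).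
* §2 `perturbed_laplacian_site_le` (`(H + K)u = f`, `|f x′| ≤ ME′`, `|u x′| ≤ E′S`, `|V x′| ≤ L`, block mean `≤ Cd·M·E′`, `|(Ku)(x′)| ≤ K′E′S`
  ⟹ `|Σ_μ(2u x′ − u(x′ ± ê_μ))| ≤ E′(M + (L + K′)S + aCdM)∕(n+1)²`).
* §3 toy.

HONEST (what this is NOT).  Letters only; rates far from sharp; cubic periods; scalar skeleton ((A3), NC-NE7b-α UNRULED); nothing of the
covariant propagators of [B4]–[B6]; nothing of Bałaban's.  BY-NAME EFFECT ON THE WALL: NONE.  NE7b NOT PRINTED ∕ NOT PROVED; spine PROVED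
0∕9; rung (B)+1 on a FINITE torus — NOT infinite volume, NOT the mass gap, NOT Clay.  HONEST DEPENDENCY: continuum YM on T⁴ ⇐ BetaPertH ∧
nine spine estimates (0∕9 proved); BetaPertH ⇐ (D1) ∧ (D4) ∧ CAP+tail; G-an2-4 gates asym, D1 and NE2∕3∕4.
-/

set_option autoImplicit false

noncomputable section

namespace Summit.QuantumFields.BalabanUV.T4Continuum.NE7b.SupTorusPerturbedBlockL1Profile

open Real
open Literature.MathematicalPhysics.QuantumFieldTheory.Balaban1983to89
open B6QGQLower276 (X e blk B side chart mem_B sum_B sum_B_const card_cube blk_chart)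
open Beta (Site siteOf windowMap siteOf_windowMap siteOf_add siteOf_sub)
open SupTorusDirichletForm (blockOf_siteOf_of_mem)
open SupTorusMaximumPrinciple (blockTerm_eq)
open SupTorusPerturbedProfile (perturbed_blockSq_le_of_blockProfile_source)

variable {d : ℕ}

/-! ## §1. The block-`ℓ¹` norms and block means of `(H + K)⁻¹f` inherit the sup profile of `f` (road's class `V ≥ −λ`) -/

section Profile

variable (n : ℕ) (a : ℝ) (s : ℕ) [NeZero s] (ha : 0 ≤ a) {lam κ ε γ γ' M : ℝ} (hκ0 : 0 < κ) (hκ1 : κ ≤ 1) (hκγ : κ < γ) (hε : 0 ≤ ε)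
  (hm : ε * (2 * (1 - exp (-(γ - κ)))⁻¹) ^ d < min 2 a - lam - 2 * d * κ ^ 2 - a * (exp (2 * d * κ) - 1)) (h2κ : 2 * κ ≤ γ')
  (V : Site d ((n + 1) * s) → ℝ) (hV : ∀ x, -lam ≤ V x)
  (K : Site d ((n + 1) * s) → Site d ((n + 1) * s) → ℝ)
  (hK : ∀ x z, |K x z| ≤ ε * exp (-(γ * ∑ i, (((x i - z i).valMinAbs.natAbs : ℕ) : ℝ))))
  (y₀ : Site d s) (u f : Site d ((n + 1) * s) → ℝ)
  (hf : ∀ x, |f x| ≤ M * exp (-(γ' * ∑ i, ((((siteOf d s (blk n (windowMap d ((n + 1) * s) x))) i - y₀ i).valMinAbs.natAbs : ℕ) : ℝ))))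
  (hu : ∀ x, ((n : ℝ) + 1) ^ 2 * ∑ μ, (2 * u x - u (x + siteOf d ((n + 1) * s) (e μ)) - u (x - siteOf d ((n + 1) * s) (e μ)))
      + a / ((n : ℝ) + 1) ^ d * ∑ q ∈ B n (blk n (windowMap d ((n + 1) * s) x)), u (siteOf d ((n + 1) * s) q) + V x * u x
      + ∑ z, K x z * u z = f x)

include hf in
/-- **THE BLOCK PROFILE OF A SUP-PROFILE SOURCE**: `|f x| ≤ M·e^{−γ′ρ_s(bt x, y₀)}` ⟹ over every block `y`,
`Σ_z f(σ(chart (wm y) z))² ≤ (√((n+1)^d)·M)²·e^{−2γ′ρ_s(y,y₀)}` (the `(n+1)^d` sites of the block all have `bt = y`). [folklore] -/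
theorem supProfile_blockSq_le (y : Site d s) :
    ∑ z : Fin d → Fin (n + 1), f (siteOf d ((n + 1) * s) (chart n (windowMap d s y) z)) ^ 2
      ≤ (√(((n : ℝ) + 1) ^ d) * M) ^ 2 * exp (-(2 * γ' * ∑ i, (((y i - y₀ i).valMinAbs.natAbs : ℕ) : ℝ))) := by
  classical
  have hvol : (0 : ℝ) ≤ ((n : ℝ) + 1) ^ d := by positivity
  have hblk : ∀ z : Fin d → Fin (n + 1),
      siteOf d s (blk n (windowMap d ((n + 1) * s) (siteOf d ((n + 1) * s) (chart n (windowMap d s y) z)))) = y := fun z =>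
    blockOf_siteOf_of_mem n s (mem_B.2 (blk_chart n (windowMap d s y) z))
  have hterm : ∀ z : Fin d → Fin (n + 1), f (siteOf d ((n + 1) * s) (chart n (windowMap d s y) z)) ^ 2
      ≤ M ^ 2 * exp (-(2 * γ' * ∑ i, (((y i - y₀ i).valMinAbs.natAbs : ℕ) : ℝ))) := fun z => by
    have h := hf (siteOf d ((n + 1) * s) (chart n (windowMap d s y) z))
    rw [hblk z] at h
    have h1 : f (siteOf d ((n + 1) * s) (chart n (windowMap d s y) z)) ^ 2
        ≤ (M * exp (-(γ' * ∑ i, (((y i - y₀ i).valMinAbs.natAbs : ℕ) : ℝ)))) ^ 2 := by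
      rw [← sq_abs]; exact pow_le_pow_left₀ (abs_nonneg _) h 2
    have h2 : (M * exp (-(γ' * ∑ i, (((y i - y₀ i).valMinAbs.natAbs : ℕ) : ℝ)))) ^ 2
        = M ^ 2 * exp (-(2 * γ' * ∑ i, (((y i - y₀ i).valMinAbs.natAbs : ℕ) : ℝ))) := by
      rw [mul_pow, sq (exp _), ← exp_add]; congr 1; congr 1; ring
    rw [h2] at h1
    exact h1
  calc ∑ z : Fin d → Fin (n + 1), f (siteOf d ((n + 1) * s) (chart n (windowMap d s y) z)) ^ 2
      ≤ ∑ _z : Fin d → Fin (n + 1), M ^ 2 * exp (-(2 * γ' * ∑ i, (((y i - y₀ i).valMinAbs.natAbs : ℕ) : ℝ))) :=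
        Finset.sum_le_sum fun z _ => hterm z
    _ = ((n : ℝ) + 1) ^ d * (M ^ 2 * exp (-(2 * γ' * ∑ i, (((y i - y₀ i).valMinAbs.natAbs : ℕ) : ℝ)))) := by
        rw [Finset.sum_const, Finset.card_univ, nsmul_eq_mul, card_cube]
    _ = _ := by rw [mul_pow, Real.sq_sqrt hvol]; ring

include ha hκ0 hκ1 hκγ hε hm h2κ hV hK hf hu in
/-- **THE BLOCK-`ℓ¹` NORMS OF `(H + K)⁻¹f` INHERIT THE SOURCE'S SUP PROFILE** (road's class `V ≥ −λ`, small local kernels):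
`Σ_z |u(σ(chart (wm y) z))| ≤ (n+1)^d·(m_κ − εK_{γ−κ})⁻¹e^{2dκ}·M·K_{2κ}·e^{−κρ_s(y,y₀)}` — Cauchy–Schwarz on (167)
`perturbed_blockSq_le_of_blockProfile_source` at the block profile of §1 (`G² = (n+1)^d M²`), and `K_{2κ} ≤ K_{2κ}²`. [folklore] -/
theorem perturbed_blockL1_le_of_supProfile (y : Site d s) :
    ∑ z : Fin d → Fin (n + 1), |u (siteOf d ((n + 1) * s) (chart n (windowMap d s y) z))|
      ≤ ((n : ℝ) + 1) ^ d * ((min 2 a - lam - 2 * d * κ ^ 2 - a * (exp (2 * d * κ) - 1)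
          - ε * (2 * (1 - exp (-(γ - κ)))⁻¹) ^ d)⁻¹ * exp (2 * d * κ)) * M
        * (2 * (1 - exp (-(2 * κ)))⁻¹) ^ d * exp (-(κ * ∑ i, (((y i - y₀ i).valMinAbs.natAbs : ℕ) : ℝ))) := by
  classical
  set m := min 2 a - lam - 2 * d * κ ^ 2 - a * (exp (2 * d * κ) - 1) - ε * (2 * (1 - exp (-(γ - κ)))⁻¹) ^ d with hm_def
  set Kk : ℝ := (2 * (1 - exp (-(2 * κ)))⁻¹) ^ d with hKk
  have hvol : (0 : ℝ) < ((n : ℝ) + 1) ^ d := by positivity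
  have hmpos : 0 < m := by rw [hm_def]; linarith
  have hminv : 0 ≤ m⁻¹ := inv_nonneg.2 hmpos.le
  have hM : 0 ≤ M := by
    have h1 := (abs_nonneg _).trans (hf (siteOf d ((n + 1) * s) (chart n (windowMap d s y₀) 0)))
    exact le_of_mul_le_mul_right (by rw [zero_mul]; exact h1) (exp_pos _)
  -- `K_{2κ} ≥ 1`, so `K_{2κ} ≤ K_{2κ}²`
  have hbase : (1 : ℝ) ≤ 2 * (1 - exp (-(2 * κ)))⁻¹ := by
    have h1 : 0 < 1 - exp (-(2 * κ)) := sub_pos.2 (exp_lt_one_iff.2 (by linarith))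
    have h2 : 1 - exp (-(2 * κ)) ≤ 1 := by linarith [exp_pos (-(2 * κ))]
    have h3 : (1 : ℝ) ≤ (1 - exp (-(2 * κ)))⁻¹ := one_le_inv_iff₀.2 ⟨h1, h2⟩
    linarith
  have hKk1 : 1 ≤ Kk := one_le_pow₀ hbase
  have hKk0 : 0 ≤ Kk := zero_le_one.trans hKk1
  have hKk2 : Kk ≤ Kk ^ 2 := by rw [sq]; exact le_mul_of_one_le_left hKk0 hKk1
  -- Cauchy–Schwarz on the block
  have hCS := sq_sum_le_card_mul_sum_sq (s := (Finset.univ : Finset (Fin d → Fin (n + 1))))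
    (f := fun z => |u (siteOf d ((n + 1) * s) (chart n (windowMap d s y) z))|)
  rw [Finset.card_univ, card_cube] at hCS
  simp only [sq_abs] at hCS
  have hsq := perturbed_blockSq_le_of_blockProfile_source n a s ha hκ0 hκ1 hκγ hε hm h2κ V hV K hK y₀ u f hu
    (supProfile_blockSq_le n s y₀ f hf) y
  have eG : (√(((n : ℝ) + 1) ^ d) * M) ^ 2 = ((n : ℝ) + 1) ^ d * M ^ 2 := by rw [mul_pow, Real.sq_sqrt hvol.le]
  rw [eG] at hsq
  have h4 : exp (4 * d * κ) = exp (2 * d * κ) ^ 2 := by rw [sq, ← exp_add]; ring_nf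
  have h5 : exp (-(2 * κ * ∑ i, (((y i - y₀ i).valMinAbs.natAbs : ℕ) : ℝ)))
      = exp (-(κ * ∑ i, (((y i - y₀ i).valMinAbs.natAbs : ℕ) : ℝ))) ^ 2 := by rw [sq, ← exp_add]; ring_nf
  have hR : 0 ≤ ((n : ℝ) + 1) ^ d * (m⁻¹ * exp (2 * d * κ)) * M * Kk * exp (-(κ * ∑ i, (((y i - y₀ i).valMinAbs.natAbs : ℕ) : ℝ))) := by
    positivity
  have hsq2 : (∑ z : Fin d → Fin (n + 1), |u (siteOf d ((n + 1) * s) (chart n (windowMap d s y) z))|) ^ 2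
      ≤ (((n : ℝ) + 1) ^ d * (m⁻¹ * exp (2 * d * κ)) * M * Kk * exp (-(κ * ∑ i, (((y i - y₀ i).valMinAbs.natAbs : ℕ) : ℝ)))) ^ 2 := by
    refine hCS.trans ((mul_le_mul_of_nonneg_left hsq hvol.le).trans ?_)
    have e1 : ((n : ℝ) + 1) ^ d * ((m⁻¹) ^ 2 * (((n : ℝ) + 1) ^ d * M ^ 2 * exp (2 * d * κ) * Kk) * exp (2 * d * κ)
          * exp (-(2 * κ * ∑ i, (((y i - y₀ i).valMinAbs.natAbs : ℕ) : ℝ))))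
        = (((n : ℝ) + 1) ^ d * (m⁻¹ * exp (2 * d * κ)) * M * exp (-(κ * ∑ i, (((y i - y₀ i).valMinAbs.natAbs : ℕ) : ℝ)))) ^ 2 * Kk := by
      rw [h5]; ring
    have e2 : (((n : ℝ) + 1) ^ d * (m⁻¹ * exp (2 * d * κ)) * M * Kk * exp (-(κ * ∑ i, (((y i - y₀ i).valMinAbs.natAbs : ℕ) : ℝ)))) ^ 2
        = (((n : ℝ) + 1) ^ d * (m⁻¹ * exp (2 * d * κ)) * M * exp (-(κ * ∑ i, (((y i - y₀ i).valMinAbs.natAbs : ℕ) : ℝ)))) ^ 2 * Kk ^ 2 := by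
      ring
    rw [e1, e2]
    exact mul_le_mul_of_nonneg_left hKk2 (sq_nonneg _)
  exact (abs_le_of_sq_le_sq' hsq2 hR).2

include ha hκ0 hκ1 hκγ hε hm h2κ hV hK hf hu in
/-- **THE BLOCK MEANS OF `(H + K)⁻¹f` INHERIT THE SOURCE'S SUP PROFILE**: `|(n+1)^{−d}Σ_z u(σ(chart (wm y) z))| ≤ (m_κ − εK_{γ−κ})⁻¹e^{2dκ}·M·
K_{2κ}·e^{−κρ_s(y,y₀)}` — the mean is at most `(n+1)^{−d}` times the block-`ℓ¹` norm. [folklore] -/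
theorem perturbed_blockMean_le_of_supProfile (y : Site d s) :
    |(((n : ℝ) + 1) ^ d)⁻¹ * ∑ z : Fin d → Fin (n + 1), u (siteOf d ((n + 1) * s) (chart n (windowMap d s y) z))|
      ≤ ((min 2 a - lam - 2 * d * κ ^ 2 - a * (exp (2 * d * κ) - 1) - ε * (2 * (1 - exp (-(γ - κ)))⁻¹) ^ d)⁻¹ * exp (2 * d * κ)) * M
        * (2 * (1 - exp (-(2 * κ)))⁻¹) ^ d * exp (-(κ * ∑ i, (((y i - y₀ i).valMinAbs.natAbs : ℕ) : ℝ))) := by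
  classical
  have hvol : (0 : ℝ) < ((n : ℝ) + 1) ^ d := by positivity
  have h := perturbed_blockL1_le_of_supProfile n a s ha hκ0 hκ1 hκγ hε hm h2κ V hV K hK y₀ u f hf hu y
  rw [abs_mul, abs_inv, abs_of_pos hvol, inv_mul_le_iff₀ hvol]
  calc |∑ z : Fin d → Fin (n + 1), u (siteOf d ((n + 1) * s) (chart n (windowMap d s y) z))|
      ≤ ∑ z : Fin d → Fin (n + 1), |u (siteOf d ((n + 1) * s) (chart n (windowMap d s y) z))| := Finset.abs_sum_le_sum_abs _ _
    _ ≤ _ := h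
    _ = _ := by ring

end Profile

/-! ## §2. The second-difference sum at a site, from the perturbed equation -/

/-- **THE SECOND-DIFFERENCE SUM AT A SITE, FROM `(H + K)u = f`**: at `x′ = σ(chart n (wm y′) z′)`, bounds `|f x′| ≤ M·E′`, `|u x′| ≤ E′·S`,
`|V x′| ≤ L`, `|(n+1)^{−d}Σ_z u(σ(chart (wm y′) z))| ≤ Cd·M·E′` and `|Σ_z K(x′,z)u(z)| ≤ K′·E′·S` give
`|Σ_μ(2u x′ − u(x′+ê_μ) − u(x′−ê_μ))| ≤ E′(M + (L + K′)S + a·Cd·M)∕(n+1)²` ((144) `blockTerm_eq`; the kernel term enters like the potential term).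
[folklore] -/
theorem perturbed_laplacian_site_le (n : ℕ) (a : ℝ) (s : ℕ) [NeZero s] (ha : 0 ≤ a) {L K' M S E' Cd : ℝ} (hL : 0 ≤ L)
    (V u f : Site d ((n + 1) * s) → ℝ) (K : Site d ((n + 1) * s) → Site d ((n + 1) * s) → ℝ)
    (hu : ∀ x, ((n : ℝ) + 1) ^ 2 * ∑ μ, (2 * u x - u (x + siteOf d ((n + 1) * s) (e μ)) - u (x - siteOf d ((n + 1) * s) (e μ)))
      + a / ((n : ℝ) + 1) ^ d * ∑ q ∈ B n (blk n (windowMap d ((n + 1) * s) x)), u (siteOf d ((n + 1) * s) q) + V x * u x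
      + ∑ z, K x z * u z = f x)
    (y' : Site d s) (z' : Fin d → Fin (n + 1))
    (hVx : |V (siteOf d ((n + 1) * s) (chart n (windowMap d s y') z'))| ≤ L)
    (hfx : |f (siteOf d ((n + 1) * s) (chart n (windowMap d s y') z'))| ≤ M * E')
    (hux : |u (siteOf d ((n + 1) * s) (chart n (windowMap d s y') z'))| ≤ E' * S)
    (hmean : |(((n : ℝ) + 1) ^ d)⁻¹ * ∑ z : Fin d → Fin (n + 1), u (siteOf d ((n + 1) * s) (chart n (windowMap d s y') z))| ≤ Cd * M * E')
    (hKx : |∑ z, K (siteOf d ((n + 1) * s) (chart n (windowMap d s y') z')) z * u z| ≤ K' * (E' * S)) :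
    |∑ μ, (2 * u (siteOf d ((n + 1) * s) (chart n (windowMap d s y') z'))
        - u (siteOf d ((n + 1) * s) (chart n (windowMap d s y') z') + siteOf d ((n + 1) * s) (e μ))
        - u (siteOf d ((n + 1) * s) (chart n (windowMap d s y') z') - siteOf d ((n + 1) * s) (e μ)))|
      ≤ E' * (M + (L + K') * S + a * (Cd * M)) / ((n : ℝ) + 1) ^ 2 := by
  have hx := hu (siteOf d ((n + 1) * s) (chart n (windowMap d s y') z'))
  rw [blockTerm_eq n s u y' z', div_eq_mul_inv] at hx
  have hsq : (0 : ℝ) < ((n : ℝ) + 1) ^ 2 := by positivity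
  rw [le_div_iff₀ hsq, ← abs_of_pos hsq, ← abs_mul, mul_comm]
  have e : ((n : ℝ) + 1) ^ 2 * ∑ μ, (2 * u (siteOf d ((n + 1) * s) (chart n (windowMap d s y') z'))
        - u (siteOf d ((n + 1) * s) (chart n (windowMap d s y') z') + siteOf d ((n + 1) * s) (e μ))
        - u (siteOf d ((n + 1) * s) (chart n (windowMap d s y') z') - siteOf d ((n + 1) * s) (e μ)))
      = f (siteOf d ((n + 1) * s) (chart n (windowMap d s y') z'))
        - a * ((((n : ℝ) + 1) ^ d)⁻¹ * ∑ z : Fin d → Fin (n + 1), u (siteOf d ((n + 1) * s) (chart n (windowMap d s y') z)))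
        - V (siteOf d ((n + 1) * s) (chart n (windowMap d s y') z')) * u (siteOf d ((n + 1) * s) (chart n (windowMap d s y') z'))
        - ∑ z, K (siteOf d ((n + 1) * s) (chart n (windowMap d s y') z')) z * u z := by
    linarith [hx]
  rw [e]
  have k2 : |a * ((((n : ℝ) + 1) ^ d)⁻¹ * ∑ z : Fin d → Fin (n + 1), u (siteOf d ((n + 1) * s) (chart n (windowMap d s y') z)))|
      ≤ a * (Cd * M * E') := by
    rw [abs_mul, abs_of_nonneg ha]; exact mul_le_mul_of_nonneg_left hmean ha
  have k3 : |V (siteOf d ((n + 1) * s) (chart n (windowMap d s y') z')) * u (siteOf d ((n + 1) * s) (chart n (windowMap d s y') z'))|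
      ≤ L * (E' * S) := by
    rw [abs_mul]; exact mul_le_mul hVx hux (abs_nonneg _) hL
  have t1 := abs_sub (f (siteOf d ((n + 1) * s) (chart n (windowMap d s y') z'))
    - a * ((((n : ℝ) + 1) ^ d)⁻¹ * ∑ z : Fin d → Fin (n + 1), u (siteOf d ((n + 1) * s) (chart n (windowMap d s y') z)))
    - V (siteOf d ((n + 1) * s) (chart n (windowMap d s y') z')) * u (siteOf d ((n + 1) * s) (chart n (windowMap d s y') z')))
    (∑ z, K (siteOf d ((n + 1) * s) (chart n (windowMap d s y') z')) z * u z)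
  have t2 := abs_sub (f (siteOf d ((n + 1) * s) (chart n (windowMap d s y') z'))
    - a * ((((n : ℝ) + 1) ^ d)⁻¹ * ∑ z : Fin d → Fin (n + 1), u (siteOf d ((n + 1) * s) (chart n (windowMap d s y') z))))
    (V (siteOf d ((n + 1) * s) (chart n (windowMap d s y') z')) * u (siteOf d ((n + 1) * s) (chart n (windowMap d s y') z')))
  have t3 := abs_sub (f (siteOf d ((n + 1) * s) (chart n (windowMap d s y') z')))
    (a * ((((n : ℝ) + 1) ^ d)⁻¹ * ∑ z : Fin d → Fin (n + 1), u (siteOf d ((n + 1) * s) (chart n (windowMap d s y') z))))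
  have e2 : E' * (M + (L + K') * S + a * (Cd * M)) = M * E' + a * (Cd * M * E') + L * (E' * S) + K' * (E' * S) := by ring
  rw [e2]
  linarith

/-! ## §3. Toy -/

/-- Toy (`d = 0`, `a = 1`, `λ = 0`, `κ = 1∕2`, `γ = 1`, `ε = 0`): §1's floor hypothesis `εK_{γ−κ} < m_κ` is inhabited. -/
example : (0 : ℝ) * (2 * (1 - exp (-((1 : ℝ) - 1 / 2)))⁻¹) ^ (0 : ℕ)
    < min 2 (1 : ℝ) - 0 - 2 * ((0 : ℕ) : ℝ) * (1 / 2 : ℝ) ^ 2 - 1 * (exp (2 * ((0 : ℕ) : ℝ) * (1 / 2 : ℝ)) - 1) := by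
  norm_num

end Summit.QuantumFields.BalabanUV.T4Continuum.NE7b.SupTorusPerturbedBlockL1Profile
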